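import Summits.ResolutionOfSingularities.ResolutionOfSingularities.Theorems.LossIsFatalLedger
import Summits.ResolutionOfSingularities.ResolutionOfSingularities.Theorems.LossIsFatalLayer2
import Summits.ResolutionOfSingularities.ResolutionOfSingularities.Theorems.LossExitCone3
import Summits.ResolutionOfSingularities.ResolutionOfSingularities.Theorems.LossExitCone5
import HarnessLib

/-!
# LossEpisode — (A) of the g28 window: the CARRIER AUTOMATON of the lossy tail (run states, loss moves, and the
complete list of arrows leaving them), kernel, hypothesis-free, every `q = pᵉ`, every field

decomp-res-lens-3, gen 28 (CRITIC-LEDGER rows 220e/220f: «(A) combine into the `IsRunState`/`runState_succ` carrier —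
bookkeeping, 0, banked by name»; it is the carrier on which `episode_measure_lt` / (W1) will be stated).  TOOLS, score 0.

After the located residual's total loss at `t ≥ N` followed by a proximity repeat (`LossIsFatalLedger.LossIsFatalStaysDeep`),
the whole infinite tail is a path in a TWO-SORTED AUTOMATON whose sorts are typed here over the landed layer calculus
(`LossIsFatalLayer{,2}`, `LossExitCone{3,4,5}`, `LossIsFatalLedger`):

* `TailHyp W N s` — the common hypothesis block of the tail from stage `N` on (plateau of shade `s`, order never `q`,
  SMALL walls `r_t(y) + 1 ≤ s`, `1 ≤ s < q`), extracted once from the binders of `LossIsFatalStaysDeep` (`tailHyp_of_binders`).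
* `IsRunState W s u i j l k m` — stage `u` is a RUN STATE with roles `(i, j, l)` = (run wall, loss wall, free letter) and
  masses `k, m ≥ 1`: `r_u = k·e_i + m·e_j` and the `u_j^m`-layer of `F_u` is `c · u_i^k u_j^m u_l^s · V`, `c ≠ 0`, `V(0) ≠ 0`.
* `IsLossMove W t` — move `t` is a TOTAL LOSS (`r_{t+1}` vanishes off the chart letter).

The three transition theorems (all PROVED, `sorry`-free):

* `runState_of_stays_loss` (ENTRY / RESTART): a total loss at `t ≥ N` followed by a proximity repeat yields a run state at
  `t + 2` with roles `(j_{t+1}, j_t, l)`, masses `(d, T)` where `ordZero F_t = q + T`, `T + s = q + d`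
  [`loss_stays_shape` + `layer_after_repeat`].
* `runState_next` (THE SIX ARROWS): from a run state `(i,j,l;k,m)` at `u ≥ N` the move `u` is exactly one of
  **R** (chart `i`, `b_u = 0`; next run state `(i,j,l; k+m+s−q, m)`) [`run_step_untranslated`, `run_letter_untranslated`],
  **X1** (chart `j`, `b_u(i) = 0`; next `(i,j,l; k, k+m+s−q)`) [`exit_succ_layer_kept`, `exit_succ_r`],
  **X2** (chart `l`, `b_u(i) = 0`, then `b_u(j) ≠ 0`; next `(i,l,j; k, k+m+s−q)`) [`switch_law`, `switch_succ_layer_kept`],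
  or a **total loss** (chart `i` with `b_u(j) ≠ 0`, chart `j` with `b_u(i) ≠ 0`, chart `l` with `b_u(i) ≠ 0`), after which
  `r_{u+1} = (k+m+s−q)·e_{j_u}`; in every case `q < k + m + s`, `k + 1 ≤ s`, `m + 1 ≤ s`.
* `lossMove_next`: after a total loss at `t ≥ N` with `r_{t+1} = T·e_{j_t}`, either move `t+1` is a proximity repeat and
  `t+2` is a run state (restart), or move `t+1` is again a total loss with the smaller mass `T + s − q < T`
  [`loss_consecutive`, `loss_data`].

So every stage `≥ t+1` of the tail is a loss stage or a run stage (`tail_trichotomy` is the packaged corollary used by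
the measure argument).  No polygon enters this file.  Imports only the landed tree.  No `sorry`, standard axioms.
-/

open MvPolynomial Finset
open Literature.AlgebraicGeometry.Resolution
open Literature.AlgebraicGeometry.Resolution.Hauser2010
open Literature.AlgebraicGeometry.Resolution.PointBlowup
open Summit.ResolutionOfSingularities.ResolutionOfSingularities.Theorems.TightDefectClasses
open Summit.ResolutionOfSingularities.ResolutionOfSingularities.Theorems.TightDefectStrongWalks
open Summit.ResolutionOfSingularities.ResolutionOfSingularities.Theorems.ItineraryCutClasses
open Summit.ResolutionOfSingularities.ResolutionOfSingularities.Theorems.BoundaryLedger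
open Summit.ResolutionOfSingularities.ResolutionOfSingularities.Theorems.ProximityCut
open Summit.ResolutionOfSingularities.ResolutionOfSingularities.Theorems.ConeCut
open Summit.ResolutionOfSingularities.ResolutionOfSingularities.Theorems.WallCut
open Summit.ResolutionOfSingularities.ResolutionOfSingularities.Theorems.WallCutCritical
open Summit.ResolutionOfSingularities.ResolutionOfSingularities.Theorems.LossIsFatal
open Summit.ResolutionOfSingularities.ResolutionOfSingularities.Theorems.LossIsFatalLayer
open Summit.ResolutionOfSingularities.ResolutionOfSingularities.Theorems.LossIsFatalLedger
open Summit.ResolutionOfSingularities.ResolutionOfSingularities.Theorems.LossExitCone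

namespace Summit.ResolutionOfSingularities.ResolutionOfSingularities.Theorems.LossEpisode

variable {K : Type} [Field K] [DecidableEq K] {q : ℕ} {s₀ : State (Fin 3) K}

/-! ## §1 The sorts of the automaton -/

/-- The common hypothesis block of the lossy tail from stage `N` on, shade `s`: plateau, order never `q`, SMALL walls,
`1 ≤ s < q`. [new] -/
structure TailHyp (W : ForcedWalk q s₀) (N s : ℕ) : Prop where
  shade : ∀ t, N ≤ t → (W.st t).shade = (s : ℕ∞)
  ne_q : ∀ t, N ≤ t → ordZero (W.st t).F ≠ ((q : ℕ) : ℕ∞)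
  small : ∀ t, N ≤ t → ∀ y, (W.st t).r y + 1 ≤ s
  one_le : 1 ≤ s
  s_lt : s < q

/-- Move `t` is a TOTAL LOSS: the boundary after it vanishes off the chart letter `j_t`. [new] -/
def IsLossMove (W : ForcedWalk q s₀) (t : ℕ) : Prop := ∀ y, y ≠ W.j t → (W.st (t + 1)).r y = 0

/-- Stage `u` is a RUN STATE of shade `s` with roles `(i, j, l)` = (run wall, loss wall, free letter) and masses `(k, m)`:
`r_u = k·e_i + m·e_j`, `k, m ≥ 1`, and the `u_j^m`-layer of `F_u` is `c · u_i^k u_j^m u_l^s · V` with `c ≠ 0`, `V(0) ≠ 0`.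
[new] -/
def IsRunState (W : ForcedWalk q s₀) (s u : ℕ) (i j l : Fin 3) (k m : ℕ) : Prop :=
  i ≠ j ∧ l ≠ i ∧ l ≠ j ∧ 1 ≤ k ∧ 1 ≤ m ∧
    (W.st u).r = Finsupp.single i k + Finsupp.single j m ∧
    ∃ c : K, ∃ V : MvPolynomial (Fin 3) K, c ≠ 0 ∧ constantCoeff V ≠ 0 ∧
      ∀ D : Fin 3 →₀ ℕ, D j = m → coeff D (W.st u).F =
        coeff D (monomial (Finsupp.single i k + Finsupp.single j m + Finsupp.single l s) c * V)

/-- The third letter. [folklore] -/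
theorem exists_third (i j : Fin 3) (hij : i ≠ j) : ∃ l : Fin 3, l ≠ i ∧ l ≠ j := by
  revert i j; decide

/-! ## §2 Ledger of a run state -/

section Ledger

variable {W : ForcedWalk q s₀} {N s : ℕ}

/-- At a run state on the tail: `ordZero F_u = s + k + m > q`, the walls are SMALL (`k + 1 ≤ s`, `m + 1 ≤ s`), and the
next stage is on the plateau. [new] [folklore] -/
theorem runState_ledger (hroot : IsRoot q s₀) (hT : TailHyp W N s) {u : ℕ} (hNu : N ≤ u) {i j l : Fin 3} {k m : ℕ}
    (hS : IsRunState W s u i j l k m) :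
    ordZero (W.st u).F = ((s + k + m : ℕ) : ℕ∞) ∧ q < s + k + m ∧ k + 1 ≤ s ∧ m + 1 ≤ s ∧
      (W.st (u + 1)).shade = (W.st u).shade := by
  classical
  obtain ⟨hij, hli, hlj, h1k, h1m, hr, -⟩ := hS
  obtain ⟨o, ho, hqo⟩ := walk_nat hroot W u
  obtain ⟨n, hn, hon⟩ := order_eq_shade_add_degree hroot W u ho
  have hns : n = s := by have h := hn.symm.trans (hT.shade u hNu); exact_mod_cast h
  have hdeg : (W.st u).r.degree = k + m := by rw [hr, map_add, Finsupp.degree_single, Finsupp.degree_single]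
  have hoe : o = s + k + m := by rw [hon, hns, hdeg, add_assoc]
  have hoq : o ≠ q := fun h => hT.ne_q u hNu (by rw [ho, h])
  have hki : (W.st u).r i = k := by
    rw [hr, Finsupp.add_apply, Finsupp.single_eq_same, Finsupp.single_apply, if_neg (fun h => hij h.symm), add_zero]
  have hmj : (W.st u).r j = m := by
    rw [hr, Finsupp.add_apply, Finsupp.single_apply, if_neg hij, Finsupp.single_eq_same, zero_add]
  refine ⟨by rw [ho, hoe], by omega, ?_, ?_, by rw [hT.shade u hNu, hT.shade (u + 1) (by omega)]⟩
  · have h := hT.small u hNu i; rwa [hki] at h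
  · have h := hT.small u hNu j; rwa [hmj] at h

end Ledger

/-! ## §3 Entry / restart: a total loss followed by a proximity repeat yields a run state -/

section Entry

variable {W : ForcedWalk q s₀} {N s : ℕ}

/-- **ENTRY / RESTART (PROVED).**  A total loss at `t ≥ N` on the tail followed by a proximity repeat (`StaysOnNewest W t`)
yields a RUN STATE at `t + 2` with run wall `j_{t+1}`, loss wall `j_t`, masses `(d, T)`: `ordZero F_t = q + T`,
`T + s = q + d`, `d ≥ 1`. [new] [folklore] -/
theorem runState_of_stays_loss (hroot : IsRoot q s₀) (hT : TailHyp W N s) {t : ℕ} (hNt : N ≤ t)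
    (hloss : IsLossMove W t) (hst : StaysOnNewest W t) :
    ∃ l : Fin 3, ∃ T d : ℕ, l ≠ W.j (t + 1) ∧ l ≠ W.j t ∧
      ordZero (W.st t).F = ((q + T : ℕ) : ℕ∞) ∧ (W.st (t + 1)).r = Finsupp.single (W.j t) T ∧ T + s = q + d ∧ 1 ≤ d ∧
      IsRunState W s (t + 2) (W.j (t + 1)) (W.j t) l d T := by
  classical
  have hsh0 := hT.shade t hNt
  have hsh1 := hT.shade (t + 1) (by omega)
  have hsh2 := hT.shade (t + 2) (by omega)
  have hne := hT.ne_q t hNt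
  have hne1 := hT.ne_q (t + 1) (by omega)
  obtain ⟨T, δ, hot, hot1, hsm, h1T, hr1, -, hr2, -⟩ := loss_stays_shape hroot W t hsh0 hsh1 hsh2 hloss hne hne1 hst
  obtain ⟨T', -, -, -, -, hk, hr1'⟩ := loss_data hroot W t hsh0 hsh1 hloss hne
  obtain ⟨l, hli, hlj⟩ := exists_third (W.j (t + 1)) (W.j t) hst.1
  have hot1' : ordZero (W.st (t + 1)).F = ((q + (δ + 1) : ℕ) : ℕ∞) := by
    rw [hot1]; congr 1; omega
  obtain ⟨c, hc, V, hV, hlayer⟩ := layer_after_repeat hroot W t hsh0 (by rw [hsh0, hsh1]) (by rw [hsh1, hsh2]) hot hot1'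
    h1T (by omega) (by omega) hk hst hli hlj
  refine ⟨l, T, δ + 1, hli, hlj, hot, hr1, by omega, by omega, ?_⟩
  refine ⟨hst.1, hli, hlj, by omega, h1T, by rw [hr2, add_comm], c, V, hc, hV, hlayer⟩

end Entry

/-! ## §4 The six arrows leaving a run state -/

section Arrows

variable {W : ForcedWalk q s₀} {N s : ℕ}

/-- The boundary after a move from a run state whose two walls are both lost (the chart letter is one of them or it is
translated away, and the other one is translated away): `r_{u+1} = (o − q)·e_{j_u}`. [folklore] -/
theorem r_succ_of_lost (W : ForcedWalk q s₀) (u : ℕ) {o : ℕ} (ho : ordZero (W.st u).F = o)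
    (hlost : ∀ y, y ≠ W.j u → W.b u y = 0 → (W.st u).r y = 0) :
    (W.st (u + 1)).r = Finsupp.single (W.j u) (o - q) := by
  classical
  have hk : kept W u = 0 := by
    ext y
    rw [kept_apply, Finsupp.zero_apply]
    by_cases h : y ≠ W.j u ∧ W.b u y = 0
    · rw [if_pos h]; exact hlost y h.1 h.2
    · rw [if_neg h]
  rw [r_succ_eq W u ho, hk, zero_add]

/-- A move whose next boundary is a single multiple of the chart letter is a total loss. [folklore] -/
theorem isLossMove_of_r_succ (W : ForcedWalk q s₀) (u : ℕ) {T : ℕ} (h : (W.st (u + 1)).r = Finsupp.single (W.j u) T) :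
    IsLossMove W u := by
  intro y hy
  rw [h, Finsupp.single_apply, if_neg (fun h' => hy h'.symm)]

/-- **THE SIX ARROWS LEAVING A RUN STATE (PROVED).**  From a run state `(i,j,l;k,m)` at `u ≥ N` on the tail the move `u` is
exactly one of: **R** (chart `i`; then `b_u = 0` and `u+1` is the run state `(i,j,l; k+m+s−q, m)`), **X1** (chart `j`,
`b_u(i) = 0`; `u+1` is the run state `(i,j,l; k, k+m+s−q)`), **X2** (chart `l`, `b_u(i) = 0`; then `b_u(j) ≠ 0` and `u+1`
is the run state `(i,l,j; k, k+m+s−q)` — the roles of `j` and `l` exchanged), or a **TOTAL LOSS** (chart `i` with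
`b_u(j) ≠ 0` / chart `j` with `b_u(i) ≠ 0` / chart `l` with `b_u(i) ≠ 0`, where `b_u(j) ≠ 0` is automatic) with
`r_{u+1} = (k+m+s−q)·e_{j_u}`.  Ledger: `q < k+m+s`, `k+1 ≤ s`, `m+1 ≤ s`. [new] [folklore] -/
theorem runState_next (hroot : IsRoot q s₀) (hT : TailHyp W N s) {u : ℕ} (hNu : N ≤ u) {i j l : Fin 3} {k m : ℕ}
    (hS : IsRunState W s u i j l k m) :
    q < k + m + s ∧ k + 1 ≤ s ∧ m + 1 ≤ s ∧
    ( (W.j u = i ∧ W.b u = 0 ∧ IsRunState W s (u + 1) i j l (k + m + s - q) m) ∨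
      (W.j u = j ∧ W.b u i = 0 ∧ IsRunState W s (u + 1) i j l k (k + m + s - q)) ∨
      (W.j u = l ∧ W.b u i = 0 ∧ W.b u j ≠ 0 ∧ IsRunState W s (u + 1) i l j k (k + m + s - q)) ∨
      (((W.j u = i ∧ W.b u j ≠ 0) ∨ (W.j u = j ∧ W.b u i ≠ 0) ∨ (W.j u = l ∧ W.b u i ≠ 0 ∧ W.b u j ≠ 0)) ∧
        IsLossMove W u ∧ (W.st (u + 1)).r = Finsupp.single (W.j u) (k + m + s - q)) ) := by
  classical
  obtain ⟨ho, hq, hks, hms, hplat⟩ := runState_ledger hroot hT hNu hS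
  obtain ⟨hij, hli, hlj, h1k, h1m, hr, c, V, hc, hV, hlayer⟩ := hS
  have hsh : (W.st u).shade = (s : ℕ∞) := hT.shade u hNu
  have h1s : 1 ≤ s := hT.one_le
  have hmq : m < q := by have := hT.s_lt; omega
  have ha : c * coeff 0 V ≠ 0 := mul_ne_zero hc (by rwa [← constantCoeff_eq] )
  have hri : (W.st u).r i = k := by
    rw [hr, Finsupp.add_apply, Finsupp.single_eq_same, Finsupp.single_apply, if_neg (fun h => hij h.symm), add_zero]
  have hrj : (W.st u).r j = m := by
    rw [hr, Finsupp.add_apply, Finsupp.single_apply, if_neg hij, Finsupp.single_eq_same, zero_add]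
  have hrl : (W.st u).r l = 0 := by
    rw [hr, Finsupp.add_apply, Finsupp.single_apply, if_neg (fun h => hli h.symm), Finsupp.single_apply,
      if_neg (fun h => hlj h.symm), add_zero]
  have hE : s + k + m - q = k + m + s - q := by omega
  refine ⟨by omega, hks, hms, ?_⟩
  rcases fin3_eq_or i j l (W.j u) hij (fun h => hli h.symm) (fun h => hlj h.symm) with hci | hcj | hcl
  · -- chart `i`: R or loss (a)
    by_cases hbj : W.b u j = 0
    · left
      have hji : j ≠ W.j u := by rw [hci]; exact fun h => hij h.symm
      have hli' : l ≠ W.j u := by rw [hci]; exact hli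
      have hlayer' : ∀ D : Fin 3 →₀ ℕ, D j = m → coeff D (W.st u).F =
          coeff D (monomial (Finsupp.single (W.j u) k + Finsupp.single j m + Finsupp.single l s) c * V) := by
        rw [hci]; exact hlayer
      have hEq : k + m + s = q + (k + m + s - q) := by omega
      -- the next boundary and order
      have hkept : kept W u = Finsupp.single j m := kept_of_run W u hji hbj (by rw [hci]; exact hr)
      have hr1 : (W.st (u + 1)).r = Finsupp.single i (k + m + s - q) + Finsupp.single j m := by
        rw [r_succ_eq W u ho, hkept, hci, add_comm]; congr 2
      obtain ⟨o₁, ho₁, -⟩ := walk_nat hroot W (u + 1)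
      obtain ⟨n₁, hn₁, hon₁⟩ := order_eq_shade_add_degree hroot W (u + 1) ho₁
      have hns₁ : n₁ = s := by have h := hn₁.symm.trans (hT.shade (u + 1) (by omega)); exact_mod_cast h
      have hdeg₁ : (W.st (u + 1)).r.degree = (k + m + s - q) + m := by
        rw [hr1, map_add, Finsupp.degree_single, Finsupp.degree_single]
      have hγ : W.b u l = 0 :=
        run_letter_untranslated hroot W u hji hli' hlj hbj h1m hmq hEq hlayer' hc hV ho₁ (by rw [hon₁, hns₁, hdeg₁]; omega)
      have hb0 : W.b u = 0 := by
        funext y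
        rcases fin3_eq_or i j l y hij (fun h => hli h.symm) (fun h => hlj h.symm) with hy | hy | hy
        · rw [hy, ← hci]; exact W.onExc u
        · rw [hy]; exact hbj
        · rw [hy]; exact hγ
      have hstep := run_step_untranslated hroot W u hji hli' hlj hbj h1m hmq hEq hlayer' hγ
      refine ⟨hci, hb0, hij, hli, hlj, by omega, h1m, hr1, c, PointBlowup.translate (W.b u) (chartMap (W.j u) V), hc,
        by rw [constantCoeff_transport _ _ (W.onExc u)]; exact hV, ?_⟩
      intro D hD
      rw [hstep D hD, hci]
    · right; right; right
      have hlost : ∀ y, y ≠ W.j u → W.b u y = 0 → (W.st u).r y = 0 := by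
        intro y hy hby
        rcases fin3_eq_or i j l y hij (fun h => hli h.symm) (fun h => hlj h.symm) with hy' | hy' | hy'
        · exact absurd (hy'.trans hci.symm) hy
        · exact absurd (hy' ▸ hby) hbj
        · rw [hy']; exact hrl
      have hr1 := r_succ_of_lost W u ho hlost
      rw [hE] at hr1
      exact ⟨Or.inl ⟨hci, hbj⟩, isLossMove_of_r_succ W u hr1, hr1⟩
  · -- chart `j`: X1 or loss (b)
    have hij' : i ≠ W.j u := by rw [hcj]; exact hij
    have hlj' : l ≠ W.j u := by rw [hcj]; exact hlj
    have hr' : (W.st u).r = Finsupp.single i k + Finsupp.single (W.j u) m := by rw [hcj]; exact hr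
    have hlayer' : ∀ D : Fin 3 →₀ ℕ, D (W.j u) = m → coeff D (W.st u).F =
        coeff D (monomial (Finsupp.single i k + Finsupp.single (W.j u) m + Finsupp.single l s) c * V) := by
      rw [hcj]; exact hlayer
    by_cases hbi : W.b u i = 0
    · right; left
      have hr1 := exit_succ_r hroot W u hij' hlj' hr' hsh hplat hq hlayer' hbi
      have hstep := exit_succ_layer_kept hroot W u hij' hlj' hr' hsh hplat hq hlayer' hbi
      refine ⟨hcj, hbi, hij, hli, hlj, h1k, by omega, by rw [hr1, hcj, hE], c * coeff 0 V, 1, ha,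
        by rw [map_one]; exact one_ne_zero, ?_⟩
      intro D hD
      rw [mul_one, hstep D (by rw [hcj, hD, hE]), hcj, hE]
    · right; right; right
      have hlost : ∀ y, y ≠ W.j u → W.b u y = 0 → (W.st u).r y = 0 := by
        intro y hy hby
        rcases fin3_eq_or i j l y hij (fun h => hli h.symm) (fun h => hlj h.symm) with hy' | hy' | hy'
        · exact absurd (hy' ▸ hby) hbi
        · exact absurd (hy'.trans hcj.symm) hy
        · rw [hy']; exact hrl
      have hr1 := r_succ_of_lost W u ho hlost
      rw [hE] at hr1
      exact ⟨Or.inr (Or.inl ⟨hcj, hbi⟩), isLossMove_of_r_succ W u hr1, hr1⟩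
  · -- chart `l`: X2 or loss (c); `b_u(j) ≠ 0` either way (`switch_law`)
    have hil' : i ≠ W.j u := by rw [hcl]; exact fun h => hli h.symm
    have hjl' : j ≠ W.j u := by rw [hcl]; exact fun h => hlj h.symm
    have hlayer' : ∀ D : Fin 3 →₀ ℕ, D j = m → coeff D (W.st u).F =
        coeff D (monomial (Finsupp.single i k + Finsupp.single j m + Finsupp.single (W.j u) s) c * V) := by
      rw [hcl]; exact hlayer
    have hlaw := switch_law hroot W u hil' hjl' hij hr hsh hplat hq h1s ha hlayer'
    have hbj : W.b u j ≠ 0 := hlaw.2.1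
    by_cases hbi : W.b u i = 0
    · right; right; left
      have hr1 := switch_succ_r hroot W u hil' hjl' hij hr hsh hplat hq h1s ha hlayer' hbi
      have hstep := switch_succ_layer_kept hroot W u hil' hjl' hij hr hsh hplat hq h1s ha hlayer' hbi
      refine ⟨hcl, hbi, hbj, fun h => hli h.symm, hij.symm, fun h => hlj h.symm, h1k, by omega,
        by rw [hr1, hcl, hE], (c * coeff 0 V) / (-W.b u j) ^ s, (X j + C (W.b u j)) ^ m,
        div_ne_zero ha (pow_ne_zero _ (neg_ne_zero.mpr hbj)), ?_, ?_⟩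
      · rw [map_pow, map_add, constantCoeff_X, constantCoeff_C, zero_add]; exact pow_ne_zero _ hbj
      · intro D hD
        rw [hstep D (by rw [hcl, hD, hE]), hcl, hE]
    · right; right; right
      have hlost : ∀ y, y ≠ W.j u → W.b u y = 0 → (W.st u).r y = 0 := by
        intro y hy hby
        rcases fin3_eq_or i j l y hij (fun h => hli h.symm) (fun h => hlj h.symm) with hy' | hy' | hy'
        · exact absurd (hy' ▸ hby) hbi
        · exact absurd (hy' ▸ hby) hbj
        · exact absurd (hy'.trans hcl.symm) hy
      have hr1 := r_succ_of_lost W u ho hlost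
      rw [hE] at hr1
      exact ⟨Or.inr (Or.inr ⟨hcl, hbi, hbj⟩), isLossMove_of_r_succ W u hr1, hr1⟩

end Arrows

end Summit.ResolutionOfSingularities.ResolutionOfSingularities.Theorems.LossEpisode
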